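import Literature.NumberTheory.DiophantineGeometry.HyperellipticCoordinateRingDedekind
import Literature.Algebra.Derivations.DerivationOrder
import Mathlib.RingTheory.Derivation.MapCoeffs
import Mathlib.Algebra.Polynomial.Derivation
import Mathlib.FieldTheory.Perfect
import Mathlib.Algebra.Algebra.Rat
import HarnessLib

/-!
# The tangent derivation of a double cover `y² = f(x)` and its transversality at every closed point

Sequel to `Literature.NumberTheory.DiophantineGeometry.HyperellipticCoordinateRingDedekind`
(`CoordRing f = K[X][Y]/(Y² − f)`).  The vector field `D := 2y·∂/∂x + f′(x)·∂/∂y` on the plane is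
tangent to the curve `C_f : y² = f(x)` (`D(Y² − f) = 2Y·f′ − f′·2Y = 0`), hence induces a
`K`-derivation of the coordinate ring

  `tangentDerivation f : Derivation K (CoordRing f) (CoordRing f)`,  `D(p(x)) = 2y·p′(x)`, `D y = f′(x)`

— the derivation dual to the regular differential `dx/(2y)` of a hyperelliptic curve (Stichtenoth,
*Algebraic Function Fields and Codes*, Prop. 6.2.3 and the computation of the holomorphic
differentials of `y² = f(x)` in its proof / Ex. 6.2.4) [cite: Stichtenoth2009, Prop 6.2.3].  Main
point: for `f` SQUAREFREE over a field of characteristic zero, `D` is TRANSVERSAL to every maximal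
ideal `𝔪` (it does not vanish at any closed point of the smooth affine curve):

* `tangentDerivation_gen_not_mem` — if `y ∉ 𝔪`: `D(p(x)) = 2y·p′(x) ∉ 𝔪` for the generator `p` of
  `𝔪 ∩ K[X]` (`p` is separable);
* `tangentDerivation_root_not_mem` — if `y ∈ 𝔪`: `D y = f′(x) ∉ 𝔪` (`p ∣ f` and `f` separable).

This is exactly the hypothesis `D π ∉ P` of the tree's
`Literature.Algebra.Derivations.emultiplicity_span_derivation` (Mason, *Diophantine Equations over
Function Fields*, Ch. I §2 (6): a transversal derivation lowers the order by one), whence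
`emultiplicity_tangentDerivation`: **`ord_𝔪 (D g) = ord_𝔪 g − 1`** for every `g` with `ord_𝔪 g ≥ 1`,
at EVERY maximal ideal `𝔪` of the Dedekind domain `CoordRing f`.

Construction: `coeffDerivation` (differentiate the coefficients, `∂/∂x` on `K[X][Y]`, via Mathlib's
`Derivation.mapCoeffs`), `yDerivation` (`∂/∂y`, Mathlib's `Polynomial.mkDerivation`), their
combination `planeTangentDerivation f = 2Y·∂/∂x + C f′·∂/∂y`, which kills `Y² − C f` and therefore
descends along `K[X][Y] → CoordRing f` (Mathlib `Derivation.liftOfSurjective`).  Written for the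
abc-iut cell's classical support item `GenEllTwo` (curve `s² = 1 − 4r^e`; there `r²s³·d/dr =
(r²s²/2)·D`), but generic; no instances are declared.
-/

noncomputable section

open Polynomial
open scoped Polynomial.Bivariate

namespace Literature.NumberTheory.DiophantineGeometry.HyperellipticCoordinateRing

universe u

variable {K : Type u} [Field K]

/-! ### Two derivations of `K[X][Y]`: `∂/∂x` on coefficients and `∂/∂y` -/

/-- `∂/∂x` on `K[X][Y]`: differentiate every coefficient (Mathlib `Derivation.mapCoeffs` of
`Polynomial.derivative'`, read back in `K[X][Y]`). [cite: Stichtenoth2009, Prop 6.2.3] -/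
def coeffDerivation : Derivation K K[X][Y] K[X][Y] :=
  (PolynomialModule.equivPolynomialSelf (R := K[X])).toLinearMap.compDer
    (derivative' : Derivation K K[X] K[X]).mapCoeffs

/-- `∂/∂x` of a monomial `c(x)·Y^n` is `c′(x)·Y^n`. [cite: Stichtenoth2009, Prop 6.2.3] -/
theorem coeffDerivation_monomial (n : ℕ) (c : K[X]) :
    coeffDerivation (monomial n c) = monomial n (derivative c) := by
  simp [coeffDerivation, Derivation.mapCoeffs_monomial]

/-- `∂/∂x (C c) = C c′`. [cite: Stichtenoth2009, Prop 6.2.3] -/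
theorem coeffDerivation_C (c : K[X]) : coeffDerivation (C c : K[X][Y]) = C (derivative c) := by
  rw [← monomial_zero_left, coeffDerivation_monomial, monomial_zero_left]

/-- `∂/∂x (Y) = 0`. [cite: Stichtenoth2009, Prop 6.2.3] -/
theorem coeffDerivation_Y : coeffDerivation (Y : K[X][Y]) = 0 := by
  rw [← monomial_one_one_eq_X, coeffDerivation_monomial, derivative_one, monomial_zero_right]

/-- `∂/∂y` on `K[X][Y]` (Mathlib `Polynomial.mkDerivation` with value `1` on `Y`, scalars restricted
to `K`). [cite: Stichtenoth2009, Prop 6.2.3] -/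
def yDerivation : Derivation K K[X][Y] K[X][Y] :=
  (Polynomial.mkDerivation K[X] (1 : K[X][Y])).restrictScalars K

/-- `∂/∂y (C c) = 0`. [cite: Stichtenoth2009, Prop 6.2.3] -/
theorem yDerivation_C (c : K[X]) : yDerivation (C c : K[X][Y]) = 0 := by
  simp [yDerivation]

/-- `∂/∂y (Y) = 1`. [cite: Stichtenoth2009, Prop 6.2.3] -/
theorem yDerivation_Y : yDerivation (Y : K[X][Y]) = 1 := by
  simp [yDerivation, Polynomial.mkDerivation_apply]

/-! ### The tangent field `2Y·∂/∂x + f′(x)·∂/∂y` -/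

variable (f : K[X])

/-- The plane vector field `2Y·∂/∂x + C f′·∂/∂y` on `K[X][Y]`. [cite: Stichtenoth2009, Prop 6.2.3] -/
def planeTangentDerivation : Derivation K K[X][Y] K[X][Y] :=
  (2 * Y : K[X][Y]) • coeffDerivation + (C (derivative f) : K[X][Y]) • yDerivation

/-- On coefficients: `D (C c) = 2Y·C c′`. [cite: Stichtenoth2009, Prop 6.2.3] -/
theorem planeTangentDerivation_C (c : K[X]) :
    planeTangentDerivation f (C c) = 2 * Y * C (derivative c) := by
  simp [planeTangentDerivation, Derivation.add_apply, Derivation.smul_apply, coeffDerivation_C,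
    yDerivation_C, smul_eq_mul]

/-- `D (Y) = C f′`. [cite: Stichtenoth2009, Prop 6.2.3] -/
theorem planeTangentDerivation_Y : planeTangentDerivation f (Y : K[X][Y]) = C (derivative f) := by
  simp [planeTangentDerivation, Derivation.add_apply, Derivation.smul_apply, coeffDerivation_Y,
    yDerivation_Y, smul_eq_mul]

/-- **Tangency**: `D (Y² − C f) = 2Y·C f′ − C f′·2Y = 0`. [cite: Stichtenoth2009, Prop 6.2.3] -/
theorem planeTangentDerivation_poly : planeTangentDerivation f (poly f) = 0 := by
  rw [poly, map_sub, Derivation.leibniz_pow, planeTangentDerivation_Y, planeTangentDerivation_C]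
  simp only [smul_eq_mul]
  ring

/-- `D` preserves the ideal `(Y² − C f)`: `D(g·h) = g·D h ∈ (g)`. [cite: Stichtenoth2009, Prop 6.2.3] -/
theorem planeTangentDerivation_mem_span {q : K[X][Y]} (hq : q ∈ Ideal.span {poly f}) :
    planeTangentDerivation f q ∈ Ideal.span {poly f} := by
  obtain ⟨h, rfl⟩ := Ideal.mem_span_singleton'.mp hq
  rw [Derivation.leibniz, planeTangentDerivation_poly, smul_zero, zero_add, smul_eq_mul]
  exact Ideal.mul_mem_right _ _ (Ideal.mem_span_singleton_self _)

/-! ### The tangent derivation of `K[C_f]` -/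

/-- The kernel condition for the descent: the plane tangent field maps the kernel of
`K[X][Y] → K[C_f]` into itself. [cite: Stichtenoth2009, Prop 6.2.3] -/
theorem planeTangentDerivation_ker (q : K[X][Y])
    (hq : Ideal.Quotient.mkₐ K (Ideal.span {poly f}) q = 0) :
    Ideal.Quotient.mkₐ K (Ideal.span {poly f}) (planeTangentDerivation f q) = 0 :=
  Ideal.Quotient.eq_zero_iff_mem.mpr
    (planeTangentDerivation_mem_span f (Ideal.Quotient.eq_zero_iff_mem.mp hq))

/-- **The tangent derivation** `D = 2y·∂/∂x + f′(x)·∂/∂y` of the coordinate ring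
`K[C_f] = K[X][Y]/(Y² − f)`, the descent of `planeTangentDerivation f` along the quotient map
(dual to the differential `dx/2y`). [cite: Stichtenoth2009, Prop 6.2.3] -/
def tangentDerivation : Derivation K (CoordRing f) (CoordRing f) :=
  Derivation.liftOfSurjective (f := Ideal.Quotient.mkₐ K (Ideal.span {poly f}))
    (Ideal.Quotient.mkₐ_surjective K _) (d := planeTangentDerivation f) (planeTangentDerivation_ker f)

/-- `D` commutes with the quotient map: `D (mk q) = mk (D₀ q)`. [cite: Stichtenoth2009, Prop 6.2.3] -/
theorem tangentDerivation_mk (q : K[X][Y]) :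
    tangentDerivation f (AdjoinRoot.mk (poly f) q) =
      AdjoinRoot.mk (poly f) (planeTangentDerivation f q) :=
  Derivation.liftOfSurjective_apply (f := Ideal.Quotient.mkₐ K (Ideal.span {poly f}))
    (Ideal.Quotient.mkₐ_surjective K _) (planeTangentDerivation_ker f) q

/-- **`D(p(x)) = 2y·p′(x)`**. [cite: Stichtenoth2009, Prop 6.2.3] -/
theorem tangentDerivation_algebraMap (c : K[X]) :
    tangentDerivation f (algebraMap K[X] (CoordRing f) c) =
      2 * AdjoinRoot.root (poly f) * algebraMap K[X] (CoordRing f) (derivative c) := by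
  rw [AdjoinRoot.algebraMap_eq, ← AdjoinRoot.mk_C, tangentDerivation_mk, planeTangentDerivation_C,
    map_mul, map_mul, map_ofNat, AdjoinRoot.mk_X, AdjoinRoot.mk_C]

/-- **`D y = f′(x)`**. [cite: Stichtenoth2009, Prop 6.2.3] -/
theorem tangentDerivation_root :
    tangentDerivation f (AdjoinRoot.root (poly f)) = algebraMap K[X] (CoordRing f) (derivative f) := by
  rw [← AdjoinRoot.mk_X, tangentDerivation_mk, planeTangentDerivation_Y, AdjoinRoot.mk_C,
    AdjoinRoot.algebraMap_eq]

/-! ### Transversality at every closed point (`f` squarefree, characteristic zero) -/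

section Transversal

variable {f}
variable [CharZero K] (m : Ideal (CoordRing f)) [hm : m.IsMaximal]

/-- In characteristic zero the generator `p` of `𝔪 ∩ K[X]` (irreducible) is coprime to `p′`, so
`p′(x) ∉ 𝔪`. [cite: Stichtenoth2009, Prop 6.2.3 (c)] -/
theorem algebraMap_derivative_gen_not_mem :
    algebraMap K[X] (CoordRing f) (derivative (gen m)) ∉ m := by
  intro h
  have hsep : (gen m).Separable := (irreducible_gen m).separable
  obtain ⟨a, b, hab⟩ := hsep
  have h1 : algebraMap K[X] (CoordRing f) 1 ∈ m := by
    rw [← hab, map_add, map_mul, map_mul]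
    exact m.add_mem (m.mul_mem_left _ (algebraMap_gen_mem m)) (m.mul_mem_left _ h)
  rw [map_one] at h1
  exact hm.ne_top ((Ideal.eq_top_iff_one m).mpr h1)

/-- **Transversality off `y = 0`.** If `y ∉ 𝔪` (and `2 ∈ Kˣ`), then `D(p(x)) = 2y·p′(x) ∉ 𝔪` for the
generator `p` of `𝔪 ∩ K[X]` — the tangent derivation is transversal to `𝔪`, with `π = p(x) ∈ 𝔪`.
[cite: Stichtenoth2009, Prop 6.2.3 (c)] -/
theorem tangentDerivation_gen_not_mem (hy : AdjoinRoot.root (poly f) ∉ m) :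
    tangentDerivation f (algebraMap K[X] (CoordRing f) (gen m)) ∉ m := by
  rw [tangentDerivation_algebraMap]
  have h2 : (2 : CoordRing f) ∉ m := by
    intro h2
    have hu : IsUnit (2 : CoordRing f) := by
      rw [show (2 : CoordRing f) = algebraMap K (CoordRing f) 2 from (map_ofNat _ 2).symm]
      exact (isUnit_iff_ne_zero.mpr two_ne_zero).map _
    exact hm.ne_top (Ideal.eq_top_of_isUnit_mem m h2 hu)
  intro h
  rcases hm.isPrime.mem_or_mem h with h' | h'
  · rcases hm.isPrime.mem_or_mem h' with h'' | h''
    · exact h2 h''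
    · exact hy h''
  · exact algebraMap_derivative_gen_not_mem m h'

/-- **Transversality on `y = 0`.** If `y ∈ 𝔪` and `f` is squarefree, then `D y = f′(x) ∉ 𝔪` — with
`π = y ∈ 𝔪`: `p ∣ f` (`p` the generator of `𝔪 ∩ K[X]`) and `f` is separable, so `p ∤ f′`.
[cite: Stichtenoth2009, Prop 6.2.3 (c)] -/
theorem tangentDerivation_root_not_mem (hf : Squarefree f) (hy : AdjoinRoot.root (poly f) ∈ m) :
    tangentDerivation f (AdjoinRoot.root (poly f)) ∉ m := by
  rw [tangentDerivation_root, algebraMap_mem_iff]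
  intro hdvd
  have hs : AdjoinRoot.root (poly f) - algebraMap K[X] (CoordRing f) 0 ∈ m := by
    rwa [map_zero, sub_zero]
  have hpf : gen m ∣ f := by
    have h := gen_dvd_sq_sub m hs
    rwa [zero_pow two_ne_zero, zero_sub, dvd_neg] at h
  have hsep : f.Separable := PerfectField.separable_iff_squarefree.mpr hf
  exact (irreducible_gen m).not_isUnit (hsep.isUnit_of_dvd' hpf hdvd)

/-- **The tangent derivation is transversal to every maximal ideal**: some `π ∈ 𝔪` has `D π ∉ 𝔪`
(`π = y` on `y = 0`, `π = p(x)` elsewhere; `f` squarefree, characteristic zero).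
[cite: Stichtenoth2009, Prop 6.2.3 (c)] -/
theorem exists_mem_tangentDerivation_not_mem (hf : Squarefree f) :
    ∃ π ∈ m, tangentDerivation f π ∉ m := by
  rcases em (AdjoinRoot.root (poly f) ∈ m) with hy | hy
  · exact ⟨_, hy, tangentDerivation_root_not_mem m hf hy⟩
  · exact ⟨_, algebraMap_gen_mem m, tangentDerivation_gen_not_mem m hy⟩

/-- **`ord_𝔪 (D g) = ord_𝔪 g − 1`** at every maximal ideal of `K[C_f]` (`f` squarefree of positive
degree, characteristic zero): if `emultiplicity 𝔪 (g) = n + 1` then `emultiplicity 𝔪 (D g) = n`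
(Mason's `v(df/dv) = v(f) − 1`, via the tree's `emultiplicity_span_derivation` for the Dedekind
domain `K[C_f]` and the transversal derivation `D`). [cite: Mason1984, Ch. I §2 (6)] -/
theorem emultiplicity_tangentDerivation (hf : Squarefree f) (hf0 : 0 < f.natDegree) {n : ℕ}
    {g : CoordRing f} (hg : emultiplicity m (Ideal.span {g}) = (n + 1 : ℕ)) :
    emultiplicity m (Ideal.span {tangentDerivation f g}) = n := by
  haveI : IsDedekindDomain (CoordRing f) :=
    isDedekindDomain (isUnit_iff_ne_zero.mpr two_ne_zero) hf hf0
  letI : Algebra ℚ (CoordRing f) :=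
    ((algebraMap K (CoordRing f)).comp (algebraMap ℚ K)).toAlgebra
  obtain ⟨π, hπ, hDπ⟩ := exists_mem_tangentDerivation_not_mem m hf
  exact Literature.Algebra.Derivations.emultiplicity_span_derivation
    ((tangentDerivation f).restrictScalars ℤ) (ne_bot_of_isMaximal hf hf0 m) hπ hDπ hg

end Transversal

end Literature.NumberTheory.DiophantineGeometry.HyperellipticCoordinateRing
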